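/-
Copyright: cell `pub-ymgap` (HUMAN RULING D-0062), Track A of `YM-PLAN.md`, DAG node N20 (= NE7b); R134 seat `pub-ymgap-dag-n20-d`
(strategy s3 «alternative currency», generation 7), module 15.  Released under the licence of the surrounding project.
-/
import Summits.QuantumFields.YangMills.Theorems.BalabanUVNodesN20ByValueMultiscaleCells
import HarnessLib

/-!
# YM-DAG node N20 (= NE7b), strategy s3, THE FOURTH CURRENCY «BY VALUE» (module 15): THE WALL IN MOMENT LANGUAGE — a SCALE-FACTORISED joint
# exponential plaquette moment of the bare lattice Yang–Mills state (one tilt budget PER LEVEL, hypothesis (SF)) gives the multiscale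
# cells-Peierls bound (MSP) of module 11 §3 with LEVEL-UNIFORM letters, hence the class-weight product a summable `W_K` is counted from;
# modules 12–14 prove (SF) unconditionally for ONE joint budget (summable tilts), which is why their letters decay in the level

Track A of `YM-PLAN.md` (cell `pub-ymgap`, HUMAN RULING D-0062), node **N20** = spine estimate NE7b (`T4WeightBudget.RelWeightBound` — the cell
`pub-balaban`'s OWN estimate, NOT PRINTED in [Bałaban 1983–89], NOT PROVED).  Seat `pub-ymgap-dag-n20-d` (R134, s3), generation 7, module 15 (modules
12 ∕ 13 ∕ 14: `…N20ByValueMultiscaleTilt` ∕ `…Peierls` ∕ `…Cells`).  Kernel theorems only: 0 `def`, 0 `sorry`, standard axioms; COUNT-NEUTRAL (`--supports`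
K3⁗ `SpineGivenEndpointR13Sep`, stmt-QuantumFields-20292, `--as helper`).  Restate-immune.

THE POINT.  Modules 12–14 prove the multiscale product law with rates `τ_k` that decay for two reasons: the crude domination letters AND the single joint
tilt budget (every level charged to one level-0 carrier).  This file isolates what a level-UNIFORM rate needs from the bare state, as ONE displayed property
in MOMENT language — the natural output of an inductive small-field analysis —
  (SF)  `∫ exp(β·Σ_{k≤K} t_k·Σ_{p∈Y_k}(1 − reTr Ū^k(∂p))) dμ_β ≤ exp(c_V·Σ_{k≤K} t_k·#Y_k)`  for all level-indexed families `Y` and all tilts `0 ≤ t_k ≤ a₀`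
(a budget `a₀` PER LEVEL, a volume letter `c_V` per tilted plaquette: the exponential moments FACTORISE scale by scale, i.e. quasi-independence of the
fluctuation fields across block-averaging scales with running-coupling-only constants), and shows (SF) ⇒ (MSP) with level-uniform letters ⇒ the class-weight
product on Bałaban's label tower:
* §1 (generic in the moment bound) ★ **`measureReal_multiLevel_largeField_le_of_moment`** — Markov once: ANY bound `B` on the joint moment at tilts `t ≥ 0`
  gives `μ_β{U | ∀ k ≤ K, ∀ p ∈ Y_k, ε_k ≤ 1 − reTr Ū^k(∂p)} ≤ B·exp(−β·Σ_{k≤K} t_k ε_k #Y_k)`; ★ **`measureReal_largeFieldCells_le_of_levels`** — from ANY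
  level-indexed product bound `Π_{k≤K} W_k^{#Y_k}` (size currency) to CELLS at every level, `Π_{c∈𝒞} m_{ℓ c}·W_{ℓ c}` (module 14 §0's weighted counting,
  witnesses tagged by level; module 14 §1 made generic in the weights).
* §2 ★★★ **`gibbsMeasure_multiLevel_largeField_le_prod_of_scaleFactorised`** — (SF) ⇒ `μ_β{…} ≤ Π_{k≤K}(e^{c_V a₀}·e^{−a₀ β ε_k})^{#Y_k}`: ONE Peierls factor
  per pinned plaquette of every level with the SAME rate `a₀` and volume letter `c_V·a₀` at every level; ★★ **`…_dist1_…`** (size currency) and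
  ★★★ **`gibbsMeasure_multiLevel_largeFieldCells_le_prod_of_scaleFactorised`** (cells: `Π_c m_{ℓ c}·e^{c_V a₀}·e^{−a₀ β ε_{ℓ c}²∕(2N)}`).
* §3 ★★★ **`sum_admS_integral_le_labelTower_prod_of_scaleFactorised`** — ON BAŁABAN's LABEL TOWER OF RECORD (n20-c's `labelTowerOfRecord`, module 9's
  reduction): IF the bare Wilson–Gibbs state at `β = g₀⁻² ≥ 4N` obeys (SF) up to level `K_P` THEN for every finite set `J` of pinned levels, disjoint letter
  regions `R j c` (`# ≤ m_j`), thresholds `ε_j ≥ 0`, every cutoff and every pattern pinning `D j` at `j ∈ J`, free elsewhere,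
  `Σ_{h∈admS … K′} ∫ eterm ρ₀ K′ h dμ_{K′} ≤ (Π_{j∈J, j<K′} (m_j·e^{c_V a₀}·e^{−a₀ g₀⁻² ε_j²∕(2N)})^{#D_j})·∫ρ₀ dU₀` — module 11 §3's (MSP) shape
  `(m_j·r)^{#D_j}` with `r = e^{c_V a₀}·e^{−a₀ g₀⁻² ε²∕(2N)}` LEVEL-UNIFORM when the thresholds are: (SF) ⇒ (MSP).  Module 12's `jointExpMoment_levels` IS (SF) restricted to
  the summable budget `Σ_k G^k t_k ≤ 1∕12` (proved); (SF) with a per-level budget is NOT in the tree and NOT printed as a statement — print's KIND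
  [Balaban1989LargeFieldII] (1.79) p. 383 (the inductive small-field bounds of the effective densities), the located wall of NE7b in the fourth currency.

HONEST FRAMING.  Count-neutral kernel theorems: two generic devices and three IMPLICATIONS displaying ONE hypothesis on the bare state; nothing level-uniform
is proved here.  Nothing of Bałaban's is asserted; NE7b NOT PRINTED ∕ NOT PROVED; the (α)-instance 0∕1; N20 NOT discharged (typed 28∕28, discharged count
untouched); one finite four-torus programme at fixed `ε` — NOT ℝ⁴, NOT infinite volume, NOT OS, NOT a mass gap, NOT Clay.  Residual binders of §3 as in
modules 9–14 (the two ζ-laws, (O4), regularity letters, disjoint letter regions).  References (LOCATORS only; no decl carries a cite tag): T. Bałaban,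
CMP **119** (1988) 243–285 [Balaban1988Convergent] ((3.1)–(3.5) pp. 264–265); CMP **122** (1989) 175–202 [Balaban1989LargeFieldI] ((0.1) p. 175,
(0.3)–(0.5) pp. 176–177); CMP **122** (1989) 355–392 [Balaban1989LargeFieldII] ((1.79)–(1.89) pp. 383–387).
-/

set_option autoImplicit false

noncomputable section

open scoped BigOperators

namespace Summit.QuantumFields.YangMills.BalabanUVNodes.N20ByValueMultiscaleWall

open MeasureTheory
open Literature.MathematicalPhysics.QuantumFieldTheory.Balaban1983to89
open Literature.MathematicalPhysics.QuantumFieldTheory.Balaban1983to89.T4Continuum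
open Literature.MathematicalPhysics.QuantumFieldTheory.Balaban1983to89.Node00
open Summit.QuantumFields.BalabanUV.T4Continuum.B16HistoryReprChain
open Summit.QuantumFields.BalabanUV.T4Continuum.NE7b.PrefixExtraction (admS)
open Summit.QuantumFields.BalabanUV.T4Continuum.ShellMeasureAverageIterate (iterMap)
open Summit.QuantumFields.YangMills.BalabanUVNodes.N20LCSLabelTower
open Summit.QuantumFields.YangMills.BalabanUVNodes.N20LCSAvgExpMoment (sq_div_le_one_sub_reTr_of_le_dist1)
open Summit.QuantumFields.YangMills.BalabanUVNodes.N20ByValueMultiscaleTilt (integrable_exp_levelsTilt)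
open Summit.QuantumFields.YangMills.BalabanUVNodes.N20ByValueMultiscalePeierls (measureReal_le_integral_exp_mul_exp_neg)
open Summit.QuantumFields.YangMills.BalabanUVNodes.N20ByValueMultiscaleCells (measureReal_forall_exists_le_prod)
open Summit.QuantumFields.YangMills.BalabanUVNodes.N20ByValueLabelTowerPinned
  (sum_admS_integral_labelTower_le_gibbsReal_mul iterMap_avOfRecord_eq)

/-! ## §1 Two generic devices: Markov from any joint moment bound; cells from any level-indexed product bound -/

section Generic

variable {N : ℕ} [NeZero N]

/-- ★ **MARKOV FROM ANY JOINT MOMENT BOUND.**  For `β ≥ 0`, a level-indexed family `Y`, tilts `t ≥ 0`, thresholds `ε_k` and ANY `B` bounding the joint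
multiscale exponential moment `∫ exp(β·Σ_{k≤K} t_k Σ_{p∈Y_k}(1 − reTr Ū^k(∂p))) dμ_β ≤ B`:
`μ_β{U | ∀ k ≤ K, ∀ p ∈ Y_k, ε_k ≤ 1 − reTr Ū^k(∂p)} ≤ B·exp(−β·Σ_{k≤K} t_k ε_k #Y_k)`. [folklore] -/
theorem measureReal_multiLevel_largeField_le_of_moment (P : Params) {β : ℝ} (hβ : 0 ≤ β) (K : ℕ) (Y : (k : ℕ) → Finset (Plaq P k))
    {t : ℕ → ℝ} (ht : ∀ k, 0 ≤ t k) (ε : ℕ → ℝ) {B : ℝ}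
    (hB : ∫ U, Real.exp (β * ∑ k ∈ Finset.range (K + 1), t k * ∑ p ∈ Y k, (1 - reTr (GaugeField.plaqHol
        (Averaging.iter (fun _ => BlockAveraging.blockAvg (ExpMeanLog.expMeanLogSU (n := Fin N))) k U) p)))
        ∂(T4GenFunBounds.gibbsMeasure P β : Measure (GaugeField P 0 (Matrix.specialUnitaryGroup (Fin N) ℂ))) ≤ B) :
    (T4GenFunBounds.gibbsMeasure P β : Measure (GaugeField P 0 (Matrix.specialUnitaryGroup (Fin N) ℂ))).real
        {U | ∀ k ∈ Finset.range (K + 1), ∀ p ∈ Y k, ε k ≤ 1 - reTr (GaugeField.plaqHol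
          (Averaging.iter (fun _ => BlockAveraging.blockAvg (ExpMeanLog.expMeanLogSU (n := Fin N))) k U) p)} ≤
      B * Real.exp (-(β * ∑ k ∈ Finset.range (K + 1), t k * ε k * (Y k).card)) := by
  haveI := T4GenFunBounds.isProbabilityMeasure_gibbsMeasure (G := Matrix.specialUnitaryGroup (Fin N) ℂ) P hβ
  have hmarkov := measureReal_le_integral_exp_mul_exp_neg
    (μ := (T4GenFunBounds.gibbsMeasure P β : Measure (GaugeField P 0 (Matrix.specialUnitaryGroup (Fin N) ℂ))))
    {U | ∀ k ∈ Finset.range (K + 1), ∀ p ∈ Y k, ε k ≤ 1 - reTr (GaugeField.plaqHol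
      (Averaging.iter (fun _ => BlockAveraging.blockAvg (ExpMeanLog.expMeanLogSU (n := Fin N))) k U) p)}
    (fun U => β * ∑ k ∈ Finset.range (K + 1), t k * ∑ p ∈ Y k, (1 - reTr (GaugeField.plaqHol
      (Averaging.iter (fun _ => BlockAveraging.blockAvg (ExpMeanLog.expMeanLogSU (n := Fin N))) k U) p)))
    (β * ∑ k ∈ Finset.range (K + 1), t k * ε k * (Y k).card) (fun U hU => ?_) (integrable_exp_levelsTilt P hβ K Y ht)
  · exact hmarkov.trans (mul_le_mul_of_nonneg_right hB (Real.exp_pos _).le)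
  · refine mul_le_mul_of_nonneg_left (Finset.sum_le_sum fun k hk => ?_) hβ
    rw [mul_assoc]
    refine mul_le_mul_of_nonneg_left ?_ (ht k)
    calc ε k * (Y k).card = ∑ _p ∈ Y k, ε k := by rw [Finset.sum_const, nsmul_eq_mul, mul_comm]
      _ ≤ ∑ p ∈ Y k, (1 - reTr (GaugeField.plaqHol
            (Averaging.iter (fun _ => BlockAveraging.blockAvg (ExpMeanLog.expMeanLogSU (n := Fin N))) k U) p)) :=
          Finset.sum_le_sum fun p hp => hU k hk p hp

/-- ★ **CELLS FROM ANY LEVEL-INDEXED PRODUCT BOUND** (module 14 §1, generic in the weights).  If, in the size currency, every level-indexed family costs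
`μ{U | ∀ k ≤ K, ∀ p ∈ Y_k, ε_k ≤ |Ū^k U(∂p) − 1|} ≤ Π_{k≤K} W_k^{#Y_k}` (`W ≥ 0`), then for every finite family of pins `c ∈ 𝒞` with levels
`ℓ c ≤ K`, witness sets `cells c ⊆ Plaq P (ℓ c)` of size `≤ m_{ℓ c}`, pairwise disjoint as subsets of `Σ k, Plaq P k`,
`μ{U | ∀ c ∈ 𝒞, ∃ p ∈ cells c, ε_{ℓ c} ≤ |Ū^{ℓ c}U(∂p) − 1|} ≤ Π_{c∈𝒞} m_{ℓ c}·W_{ℓ c}`. [folklore] -/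
theorem measureReal_largeFieldCells_le_of_levels (P : Params) (μ : Measure (GaugeField P 0 (Matrix.specialUnitaryGroup (Fin N) ℂ)))
    [IsFiniteMeasure μ] (K : ℕ) (ε : ℕ → ℝ) (W : ℕ → ℝ) (hW0 : ∀ k, 0 ≤ W k)
    (hlev : ∀ Y : (k : ℕ) → Finset (Plaq P k),
      μ.real {U | ∀ k ∈ Finset.range (K + 1), ∀ p ∈ Y k, ε k ≤ dist1 (GaugeField.plaqHol
        (Averaging.iter (fun _ => BlockAveraging.blockAvg (ExpMeanLog.expMeanLogSU (n := Fin N))) k U) p)} ≤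
        ∏ k ∈ Finset.range (K + 1), W k ^ (Y k).card)
    {κ : Type*} (𝒞 : Finset κ) (ℓ : κ → ℕ) (cells : (c : κ) → Finset (Plaq P (ℓ c))) (m : ℕ → ℕ)
    (hℓ : ∀ c ∈ 𝒞, ℓ c ≤ K) (hm : ∀ c ∈ 𝒞, (cells c).card ≤ m (ℓ c))
    (hdisj : ∀ c₁ ∈ 𝒞, ∀ c₂ ∈ 𝒞, c₁ ≠ c₂ →
      Disjoint ((cells c₁).map (Function.Embedding.sigmaMk (β := fun k => Plaq P k) (ℓ c₁)))
        ((cells c₂).map (Function.Embedding.sigmaMk (β := fun k => Plaq P k) (ℓ c₂)))) :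
    μ.real {U | ∀ c ∈ 𝒞, ∃ p ∈ cells c, ε (ℓ c) ≤ dist1 (GaugeField.plaqHol
        (Averaging.iter (fun _ => BlockAveraging.blockAvg (ExpMeanLog.expMeanLogSU (n := Fin N))) (ℓ c) U) p)} ≤
      ∏ c ∈ 𝒞, ((m (ℓ c) : ℝ) * W (ℓ c)) := by
  classical
  let Ev : (Σ k, Plaq P k) → Set (GaugeField P 0 (Matrix.specialUnitaryGroup (Fin N) ℂ)) := fun q =>
    {U | ε q.1 ≤ dist1 (GaugeField.plaqHol
      (Averaging.iter (fun _ => BlockAveraging.blockAvg (ExpMeanLog.expMeanLogSU (n := Fin N))) q.1 U) q.2)}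
  let cellsS : κ → Finset (Σ k, Plaq P k) := fun c =>
    (cells c).map (Function.Embedding.sigmaMk (β := fun k => Plaq P k) (ℓ c))
  have hev : {U : GaugeField P 0 (Matrix.specialUnitaryGroup (Fin N) ℂ) | ∀ c ∈ 𝒞, ∃ p ∈ cells c, ε (ℓ c) ≤
        dist1 (GaugeField.plaqHol
          (Averaging.iter (fun _ => BlockAveraging.blockAvg (ExpMeanLog.expMeanLogSU (n := Fin N))) (ℓ c) U) p)} ⊆
      {U | ∀ c ∈ 𝒞, ∃ q ∈ cellsS c, U ∈ Ev q} := by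
    intro U hU c hc
    obtain ⟨p, hp, hle⟩ := hU c hc
    exact ⟨⟨ℓ c, p⟩, Finset.mem_map_of_mem _ hp, hle⟩
  refine (measureReal_mono hev (measure_ne_top _ _)).trans ?_
  refine measureReal_forall_exists_le_prod Ev 𝒞 cellsS (fun c => m (ℓ c)) (fun c hc => ?_) hdisj (fun q => W q.1)
    (fun q => hW0 q.1) (fun c => W (ℓ c)) (fun c _ => hW0 (ℓ c)) (fun c _ q hq => ?_) (fun Yσ hYσ => ?_)
  · rw [Finset.card_map]; exact hm c hc
  · obtain ⟨p, -, rfl⟩ := Finset.mem_map.mp hq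
    exact le_rfl
  · have hlv : ∀ q ∈ Yσ, q.1 ≤ K := by
      intro q hq
      obtain ⟨c, hc, hq'⟩ := Finset.mem_biUnion.mp (hYσ hq)
      obtain ⟨p, -, rfl⟩ := Finset.mem_map.mp hq'
      exact hℓ c hc
    set Y : (k : ℕ) → Finset (Plaq P k) := fun k => Finset.univ.filter (fun p => (⟨k, p⟩ : Σ k, Plaq P k) ∈ Yσ) with hYdef
    have hmemY : ∀ (k : ℕ) (p : Plaq P k), p ∈ Y k ↔ (⟨k, p⟩ : Σ k, Plaq P k) ∈ Yσ := fun k p => by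
      rw [hYdef]; simp
    have hYσ_eq : Yσ = (Finset.range (K + 1)).sigma Y := by
      ext ⟨k, p⟩
      rw [Finset.mem_sigma, Finset.mem_range, hmemY]
      exact ⟨fun hq => ⟨Nat.lt_succ_of_le (hlv _ hq), hq⟩, fun hq => hq.2⟩
    have hsub : {U : GaugeField P 0 (Matrix.specialUnitaryGroup (Fin N) ℂ) | ∀ q ∈ Yσ, U ∈ Ev q} ⊆
        {U | ∀ k ∈ Finset.range (K + 1), ∀ p ∈ Y k, ε k ≤ dist1 (GaugeField.plaqHol
          (Averaging.iter (fun _ => BlockAveraging.blockAvg (ExpMeanLog.expMeanLogSU (n := Fin N))) k U) p)} :=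
      fun U hU k _ p hp => hU _ ((hmemY k p).mp hp)
    calc μ.real {U | ∀ q ∈ Yσ, U ∈ Ev q}
        ≤ μ.real {U | ∀ k ∈ Finset.range (K + 1), ∀ p ∈ Y k, ε k ≤ dist1 (GaugeField.plaqHol
              (Averaging.iter (fun _ => BlockAveraging.blockAvg (ExpMeanLog.expMeanLogSU (n := Fin N))) k U) p)} :=
          measureReal_mono hsub (measure_ne_top _ _)
      _ ≤ ∏ k ∈ Finset.range (K + 1), W k ^ (Y k).card := hlev Y
      _ = ∏ q ∈ Yσ, W q.1 := by
          rw [hYσ_eq, Finset.prod_sigma]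
          exact Finset.prod_congr rfl fun k _ => by simp only [Finset.prod_const]

end Generic

/-! ## §2 (SF) ⇒ the multiscale product law with LEVEL-UNIFORM letters -/

section ScaleFactorised

variable {N : ℕ} [NeZero N]

/-- ★★★ **A SCALE-FACTORISED JOINT MOMENT GIVES THE PRODUCT LAW WITH LEVEL-UNIFORM LETTERS.**  If the level-0 state `μ_β` (`β ≥ 0`) obeys, up to
level `K`,
  (SF) `∫ exp(β·Σ_{k≤K} t_k·Σ_{p∈Y_k}(1 − reTr Ū^k(∂p))) dμ_β ≤ exp(c_V·Σ_{k≤K} t_k #Y_k)` for every level-indexed family `Y` and all tilts `0 ≤ t_k ≤ a₀`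
(one budget `a₀ ≥ 0` PER LEVEL), then for all thresholds `ε_k`,
  `μ_β{U | ∀ k ≤ K, ∀ p ∈ Y_k, ε_k ≤ 1 − reTr Ū^k(∂p)} ≤ Π_{k≤K} (e^{c_V a₀}·e^{−a₀ β ε_k})^{#Y_k}`
— the SAME rate `a₀` and volume letter `c_V·a₀` at every level (Markov once at the uniform tilt `t ≡ a₀`). [folklore] -/
theorem gibbsMeasure_multiLevel_largeField_le_prod_of_scaleFactorised (P : Params) {β : ℝ} (hβ : 0 ≤ β) (K : ℕ) {a₀ cV : ℝ}
    (ha₀ : 0 ≤ a₀)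
    (hSF : ∀ (Y : (k : ℕ) → Finset (Plaq P k)) (t : ℕ → ℝ), (∀ k, 0 ≤ t k) → (∀ k, t k ≤ a₀) →
      ∫ U, Real.exp (β * ∑ k ∈ Finset.range (K + 1), t k * ∑ p ∈ Y k, (1 - reTr (GaugeField.plaqHol
          (Averaging.iter (fun _ => BlockAveraging.blockAvg (ExpMeanLog.expMeanLogSU (n := Fin N))) k U) p)))
          ∂(T4GenFunBounds.gibbsMeasure P β : Measure (GaugeField P 0 (Matrix.specialUnitaryGroup (Fin N) ℂ))) ≤
        Real.exp (cV * ∑ k ∈ Finset.range (K + 1), t k * (Y k).card))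
    (ε : ℕ → ℝ) (Y : (k : ℕ) → Finset (Plaq P k)) :
    (T4GenFunBounds.gibbsMeasure P β : Measure (GaugeField P 0 (Matrix.specialUnitaryGroup (Fin N) ℂ))).real
        {U | ∀ k ∈ Finset.range (K + 1), ∀ p ∈ Y k, ε k ≤ 1 - reTr (GaugeField.plaqHol
          (Averaging.iter (fun _ => BlockAveraging.blockAvg (ExpMeanLog.expMeanLogSU (n := Fin N))) k U) p)} ≤
      ∏ k ∈ Finset.range (K + 1), (Real.exp (cV * a₀) * Real.exp (-(a₀ * β * ε k))) ^ (Y k).card := by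
  have hmain := measureReal_multiLevel_largeField_le_of_moment P hβ K Y (t := fun _ => a₀) (fun _ => ha₀) ε
    (hSF Y (fun _ => a₀) (fun _ => ha₀) fun _ => le_rfl)
  refine hmain.trans (le_of_eq ?_)
  have h2 : Real.exp (cV * ∑ k ∈ Finset.range (K + 1), a₀ * ((Y k).card : ℝ)) =
      ∏ k ∈ Finset.range (K + 1), Real.exp (cV * a₀) ^ (Y k).card := by
    rw [Finset.mul_sum, Real.exp_sum]
    exact Finset.prod_congr rfl fun k _ => by rw [← Real.exp_nat_mul]; ring_nf
  have h3 : Real.exp (-(β * ∑ k ∈ Finset.range (K + 1), a₀ * ε k * (Y k).card)) =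
      ∏ k ∈ Finset.range (K + 1), Real.exp (-(a₀ * β * ε k)) ^ (Y k).card := by
    rw [Finset.mul_sum, ← Finset.sum_neg_distrib, Real.exp_sum]
    exact Finset.prod_congr rfl fun k _ => by rw [← Real.exp_nat_mul]; ring_nf
  rw [h2, h3, ← Finset.prod_mul_distrib]
  exact Finset.prod_congr rfl fun k _ => by rw [mul_pow]

/-- ★★ **THE SAME IN THE SIZE CURRENCY** (`ε_k ≤ |Ū^k(∂p) − 1|`, `ε_k ≥ 0`): under (SF) up to level `K`,
`μ_β{U | ∀ k ≤ K, ∀ p ∈ Y_k, ε_k ≤ |Ū^k U(∂p) − 1|} ≤ Π_{k≤K} (e^{c_V a₀}·e^{−a₀ β ε_k²∕(2N)})^{#Y_k}`. [folklore] -/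
theorem gibbsMeasure_multiLevel_largeField_dist1_le_prod_of_scaleFactorised (P : Params) {β : ℝ} (hβ : 0 ≤ β) (K : ℕ) {a₀ cV : ℝ}
    (ha₀ : 0 ≤ a₀)
    (hSF : ∀ (Y : (k : ℕ) → Finset (Plaq P k)) (t : ℕ → ℝ), (∀ k, 0 ≤ t k) → (∀ k, t k ≤ a₀) →
      ∫ U, Real.exp (β * ∑ k ∈ Finset.range (K + 1), t k * ∑ p ∈ Y k, (1 - reTr (GaugeField.plaqHol
          (Averaging.iter (fun _ => BlockAveraging.blockAvg (ExpMeanLog.expMeanLogSU (n := Fin N))) k U) p)))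
          ∂(T4GenFunBounds.gibbsMeasure P β : Measure (GaugeField P 0 (Matrix.specialUnitaryGroup (Fin N) ℂ))) ≤
        Real.exp (cV * ∑ k ∈ Finset.range (K + 1), t k * (Y k).card))
    {ε : ℕ → ℝ} (hε : ∀ k, 0 ≤ ε k) (Y : (k : ℕ) → Finset (Plaq P k)) :
    (T4GenFunBounds.gibbsMeasure P β : Measure (GaugeField P 0 (Matrix.specialUnitaryGroup (Fin N) ℂ))).real
        {U | ∀ k ∈ Finset.range (K + 1), ∀ p ∈ Y k, ε k ≤ dist1 (GaugeField.plaqHol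
          (Averaging.iter (fun _ => BlockAveraging.blockAvg (ExpMeanLog.expMeanLogSU (n := Fin N))) k U) p)} ≤
      ∏ k ∈ Finset.range (K + 1),
        (Real.exp (cV * a₀) * Real.exp (-(a₀ * β * (ε k ^ 2 / (2 * (Fintype.card (Fin N) : ℝ)))))) ^ (Y k).card := by
  haveI := T4GenFunBounds.isProbabilityMeasure_gibbsMeasure (G := Matrix.specialUnitaryGroup (Fin N) ℂ) P hβ
  have hsub : {U : GaugeField P 0 (Matrix.specialUnitaryGroup (Fin N) ℂ) | ∀ k ∈ Finset.range (K + 1), ∀ p ∈ Y k,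
        ε k ≤ dist1 (GaugeField.plaqHol
          (Averaging.iter (fun _ => BlockAveraging.blockAvg (ExpMeanLog.expMeanLogSU (n := Fin N))) k U) p)} ⊆
      {U | ∀ k ∈ Finset.range (K + 1), ∀ p ∈ Y k, ε k ^ 2 / (2 * (Fintype.card (Fin N) : ℝ)) ≤
        1 - reTr (GaugeField.plaqHol
          (Averaging.iter (fun _ => BlockAveraging.blockAvg (ExpMeanLog.expMeanLogSU (n := Fin N))) k U) p)} :=
    fun U hU k hk p hp => sq_div_le_one_sub_reTr_of_le_dist1 _ (hε k) (hU k hk p hp)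
  exact (measureReal_mono hsub (measure_ne_top _ _)).trans
    (gibbsMeasure_multiLevel_largeField_le_prod_of_scaleFactorised P hβ K ha₀ hSF
      (fun k => ε k ^ 2 / (2 * (Fintype.card (Fin N) : ℝ))) Y)

/-- ★★★ **(SF) ⇒ (MSP) ON THE BARE FIELD — CELLS AT EVERY LEVEL WITH LEVEL-UNIFORM LETTERS.**  Under (SF) up to level `K`, for thresholds `ε_k ≥ 0` and
every finite family of pins `c ∈ 𝒞` with levels `ℓ c ≤ K`, witness sets of size `≤ m_{ℓ c}` pairwise disjoint inside `Σ k, Plaq P k`: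
`μ_β{U | ∀ c ∈ 𝒞, ∃ p ∈ cells c, ε_{ℓ c} ≤ |Ū^{ℓ c}U(∂p) − 1|} ≤ Π_{c∈𝒞} m_{ℓ c}·(e^{c_V a₀}·e^{−a₀ β ε_{ℓ c}²∕(2N)})`
— the multiscale cells-Peierls bound (MSP) of module 11 §3 with the SAME rate `a₀` at every level. [folklore] -/
theorem gibbsMeasure_multiLevel_largeFieldCells_le_prod_of_scaleFactorised (P : Params) {β : ℝ} (hβ : 0 ≤ β) (K : ℕ) {a₀ cV : ℝ}
    (ha₀ : 0 ≤ a₀)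
    (hSF : ∀ (Y : (k : ℕ) → Finset (Plaq P k)) (t : ℕ → ℝ), (∀ k, 0 ≤ t k) → (∀ k, t k ≤ a₀) →
      ∫ U, Real.exp (β * ∑ k ∈ Finset.range (K + 1), t k * ∑ p ∈ Y k, (1 - reTr (GaugeField.plaqHol
          (Averaging.iter (fun _ => BlockAveraging.blockAvg (ExpMeanLog.expMeanLogSU (n := Fin N))) k U) p)))
          ∂(T4GenFunBounds.gibbsMeasure P β : Measure (GaugeField P 0 (Matrix.specialUnitaryGroup (Fin N) ℂ))) ≤
        Real.exp (cV * ∑ k ∈ Finset.range (K + 1), t k * (Y k).card))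
    {ε : ℕ → ℝ} (hε : ∀ k, 0 ≤ ε k)
    {κ : Type*} (𝒞 : Finset κ) (ℓ : κ → ℕ) (cells : (c : κ) → Finset (Plaq P (ℓ c))) (m : ℕ → ℕ)
    (hℓ : ∀ c ∈ 𝒞, ℓ c ≤ K) (hm : ∀ c ∈ 𝒞, (cells c).card ≤ m (ℓ c))
    (hdisj : ∀ c₁ ∈ 𝒞, ∀ c₂ ∈ 𝒞, c₁ ≠ c₂ →
      Disjoint ((cells c₁).map (Function.Embedding.sigmaMk (β := fun k => Plaq P k) (ℓ c₁)))
        ((cells c₂).map (Function.Embedding.sigmaMk (β := fun k => Plaq P k) (ℓ c₂)))) :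
    (T4GenFunBounds.gibbsMeasure P β : Measure (GaugeField P 0 (Matrix.specialUnitaryGroup (Fin N) ℂ))).real
        {U | ∀ c ∈ 𝒞, ∃ p ∈ cells c, ε (ℓ c) ≤ dist1 (GaugeField.plaqHol
          (Averaging.iter (fun _ => BlockAveraging.blockAvg (ExpMeanLog.expMeanLogSU (n := Fin N))) (ℓ c) U) p)} ≤
      ∏ c ∈ 𝒞, ((m (ℓ c) : ℝ) *
        (Real.exp (cV * a₀) * Real.exp (-(a₀ * β * (ε (ℓ c) ^ 2 / (2 * (Fintype.card (Fin N) : ℝ))))))) := by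
  haveI := T4GenFunBounds.isProbabilityMeasure_gibbsMeasure (G := Matrix.specialUnitaryGroup (Fin N) ℂ) P hβ
  exact measureReal_largeFieldCells_le_of_levels P _ K ε
    (fun k => Real.exp (cV * a₀) * Real.exp (-(a₀ * β * (ε k ^ 2 / (2 * (Fintype.card (Fin N) : ℝ)))))) (fun k => by positivity)
    (fun Y => gibbsMeasure_multiLevel_largeField_dist1_le_prod_of_scaleFactorised P hβ K ha₀ hSF hε Y) 𝒞 ℓ cells m hℓ hm hdisj

end ScaleFactorised

/-! ## §3 (SF) ⇒ the class-weight product on Bałaban's label tower, with level-uniform letters -/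

section LabelTower

variable (F : T4Family) (N : ℕ) [NeZero N] (ν : Stage7Numerics) (M : ℕ) (p : B12.RunParams) (g : ℕ → ℝ)

open Classical in
/-- ★★★ **(SF) ⇒ (MSP) ⇒ THE CLASS WEIGHT IS THE FULL PRODUCT WITH LEVEL-UNIFORM LETTERS** (the located wall of NE7b in the fourth currency, displayed
in MOMENT language).  IF the Wilson–Gibbs measure of the bare field at `β = g₀⁻² ≥ 0` obeys the scale-factorised joint moment bound (SF) up to level `K_P`
with per-level budget `a₀ ≥ 0` and volume letter `c_V` — NOT in the tree, NOT printed as a statement; print's KIND [Balaban1989LargeFieldII] (1.79) — THEN for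
every `E₀`, `A₁`, every `ζ` obeying the two laws with (O4)-measurable label weights, every finite set `J` of pinned levels `j < K_P`, families `D j` with
regularity letters on pairwise disjoint regions `R j c` of `≤ m_j` level-`(j+1)` plaquettes, thresholds `ε_j ≥ 0`, every cutoff `K′` and every label-family
pattern pinning `D j` at the levels `j ∈ J` and free elsewhere,
`Σ_{h ∈ admS (labelTowerOfRecord A₁ ζ) (labelPattern E) K′} ∫ eterm ρ₀ K′ h dμ_{K′} ≤
   (Π_{j∈J, j<K′} (m_j·(e^{c_V a₀}·e^{−a₀ g₀⁻² ε_j²∕(2N)}))^{#D_j}) · ∫ ρ₀ dU₀`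
— module 11 §3's shape `(m_j·r)^{#D_j}` with `r` depending on the level only through the threshold `ε_j`: a summable `W_K` is counted from such factors
(downstream, not touched).  Modules 12–14 give the same conclusion UNCONDITIONALLY with level-dependent letters. [folklore] -/
theorem sum_admS_integral_le_labelTower_prod_of_scaleFactorised (g₀ E₀ A₁ : ℝ) {a₀ cV : ℝ} (ha₀ : 0 ≤ a₀)
    (hSF : ∀ (Y : (k : ℕ) → Finset (Plaq (F.P p.K) k)) (t : ℕ → ℝ), (∀ k, 0 ≤ t k) → (∀ k, t k ≤ a₀) →
      ∫ U, Real.exp (g₀⁻¹ ^ 2 * ∑ k ∈ Finset.range (p.K + 1), t k * ∑ q ∈ Y k, (1 - reTr (GaugeField.plaqHol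
          (Averaging.iter (fun _ => BlockAveraging.blockAvg (ExpMeanLog.expMeanLogSU (n := Fin N))) k U) q)))
          ∂(T4GenFunBounds.gibbsMeasure (F.P p.K) (g₀⁻¹ ^ 2) : Measure (cfgOfRecord F N p.K 0)) ≤
        Real.exp (cV * ∑ k ∈ Finset.range (p.K + 1), t k * (Y k).card))
    {ζ : ZetaOfRecord F N ν M} (hζu : IsZetaUnity F N ν M ζ) (hζ : IsZetaAbsLeOne F N ν M ζ)
    (hω : ∀ (k : ℕ) (s : SeqOfRecord F ν M g p.K k) (t : LbOfRecord F ν p g k),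
      Measurable fun z : cfgOfRecord F N p.K (k + 1) × cfgOfRecord F N p.K k => ωOfRecord F N ν M p g k A₁ ζ s t z.2 z.1)
    (J : Finset ℕ) (hJK : ∀ j ∈ J, j < p.K)
    (D : (j : ℕ) → Finset (Iχ F ν p g j)) (R : (j : ℕ) → Iχ F ν p g j → Finset (Plaq (F.P p.K) (j + 1))) (m : ℕ → ℕ) (ε : ℕ → ℝ)
    (hε : ∀ j ∈ J, 0 ≤ ε j) (hm : ∀ j ∈ J, ∀ c ∈ D j, (R j c).card ≤ m j)
    (hdisj : ∀ j ∈ J, ∀ c₁ ∈ D j, ∀ c₂ ∈ D j, c₁ ≠ c₂ → Disjoint (R j c₁) (R j c₂))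
    (hreg : ∀ j ∈ J, ∀ c ∈ D j, ∀ V' : GaugeField (F.P p.K) (j + 1) (SU N),
      (∀ p' ∈ R j c, dist1 (GaugeField.plaqHol V' p') < ε j) → chiFactor F N ν p g j c V' = 1)
    (K' : ℕ) (E : (j : ℕ) → (Fin j → LabelPat F ν p g) → Finset (LbOfRecord F ν p g j))
    (hEpin : ∀ j ∈ J, ∀ h t, t ∈ E j h → D j ⊆ t.1) (hEfree : ∀ j, j ∉ J → ∀ h, E j h = Finset.univ) :
    ∑ h ∈ admS (labelTowerOfRecord F N ν M p g A₁ ζ) (labelPattern F ν p g E) K',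
        ∫ x, (labelTowerOfRecord F N ν M p g A₁ ζ).eterm (rhoZeroOfRecord F N p.K g₀ E₀) K' h x ∂(lawOfRecord F N p.K K') ≤
      (∏ j ∈ J.filter (· < K'), ((m j : ℝ) * (Real.exp (cV * a₀) *
          Real.exp (-(a₀ * g₀⁻¹ ^ 2 * (ε j ^ 2 / (2 * (Fintype.card (Fin N) : ℝ))))))) ^ (D j).card) *
        ∫ U, rhoZeroOfRecord F N p.K g₀ E₀ U ∂(fieldMeasure (F.P p.K) 0 (SU N)) := by
  have key := sum_admS_integral_labelTower_le_gibbsReal_mul F N ν M p g g₀ E₀ A₁ hζu hζ hω J D R ε hreg E hEpin hEfree K'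
  refine key.trans (mul_le_mul_of_nonneg_right ?_ (integral_nonneg fun U => (rhoZeroOfRecord_pos F N p.K g₀ E₀ U).le))
  have hβ0 : (0 : ℝ) ≤ g₀⁻¹ ^ 2 := sq_nonneg _
  haveI := T4GenFunBounds.isProbabilityMeasure_gibbsMeasure (G := SU N) (F.P p.K) hβ0
  -- the pins `(j, c)`, `j ∈ J`, `j < K′`, `c ∈ D j`, at level `j + 1`; thresholds re-indexed by level
  set 𝒞 : Finset (Σ j, Iχ F ν p g j) := (J.filter (· < K')).sigma D with h𝒞
  set ε' : ℕ → ℝ := fun k => max 0 (ε (k - 1)) with hε'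
  have hε'0 : ∀ k, 0 ≤ ε' k := fun k => le_max_left _ _
  have hε'J : ∀ j ∈ J, ε' (j + 1) = ε j := fun j hj => by
    rw [hε']; simp only [Nat.add_sub_cancel]; exact max_eq_right (hε j hj)
  have hmem𝒞 : ∀ x ∈ 𝒞, x.1 ∈ J ∧ x.1 < K' ∧ x.2 ∈ D x.1 := fun x hx => by
    rw [h𝒞, Finset.mem_sigma, Finset.mem_filter] at hx
    exact ⟨hx.1.1, hx.1.2, hx.2⟩
  have hcells := gibbsMeasure_multiLevel_largeFieldCells_le_prod_of_scaleFactorised (N := N) (F.P p.K) hβ0 p.K ha₀ hSF hε'0 𝒞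
    (fun x => x.1 + 1) (fun x => R x.1 x.2) (fun k => m (k - 1))
    (fun x hx => Nat.succ_le_of_lt (hJK x.1 (hmem𝒞 x hx).1))
    (fun x hx => by simpa only [Nat.add_sub_cancel] using hm x.1 (hmem𝒞 x hx).1 x.2 (hmem𝒞 x hx).2.2)
    (fun x₁ hx₁ x₂ hx₂ hne => ?_)
  · have hsub : {U : cfgOfRecord F N p.K 0 | ∀ j ∈ J, j < K' → ∀ c ∈ D j, ∃ p' ∈ R j c,
          ε j ≤ dist1 (GaugeField.plaqHol (iterMap (fun i => (avOfRecord F N p.K i).avg) (j + 1) U) p')} ⊆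
        {U | ∀ x ∈ 𝒞, ∃ p' ∈ R x.1 x.2, ε' (x.1 + 1) ≤ dist1 (GaugeField.plaqHol
          (Averaging.iter (fun _ => BlockAveraging.blockAvg (ExpMeanLog.expMeanLogSU (n := Fin N))) (x.1 + 1) U) p')} := by
      intro U hU x hx
      obtain ⟨hj, hjK, hc⟩ := hmem𝒞 x hx
      obtain ⟨p', hp', hle⟩ := hU x.1 hj hjK x.2 hc
      refine ⟨p', hp', ?_⟩
      rw [hε'J x.1 hj, ← iterMap_avOfRecord_eq]
      exact hle
    refine (measureReal_mono hsub (measure_ne_top _ _)).trans (hcells.trans (le_of_eq ?_))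
    rw [h𝒞, Finset.prod_sigma]
    refine Finset.prod_congr rfl fun j hj => ?_
    have hjJ : j ∈ J := (Finset.mem_filter.mp hj).1
    simp only [Finset.prod_const, Nat.add_sub_cancel, hε'J j hjJ]
  · obtain ⟨j₁, c₁⟩ := x₁
    obtain ⟨j₂, c₂⟩ := x₂
    obtain ⟨hj₁, -, hc₁⟩ := hmem𝒞 _ hx₁
    obtain ⟨-, -, hc₂⟩ := hmem𝒞 _ hx₂
    by_cases hj : j₁ = j₂
    · subst hj
      have hne' : c₁ ≠ c₂ := fun hc => hne (by rw [hc])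
      exact (Finset.disjoint_map _).mpr (hdisj j₁ hj₁ c₁ hc₁ c₂ hc₂ hne')
    · refine Finset.disjoint_left.mpr fun q hq₁ hq₂ => hj ?_
      obtain ⟨p₁, -, rfl⟩ := Finset.mem_map.mp hq₁
      obtain ⟨p₂, -, hq⟩ := Finset.mem_map.mp hq₂
      have := congrArg Sigma.fst hq
      simp only [Function.Embedding.sigmaMk_apply] at this
      omega

end LabelTower

end Summit.QuantumFields.YangMills.BalabanUVNodes.N20ByValueMultiscaleWall

end

/-! ## Erratum to the header prose (v1.1, append-only; no declaration changed): (SF) is OVER-STRONG IN SHAPE — the wall is the event law (MSP)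

The header (and the docstrings of §2–§3) gloss hypothesis (SF) — a joint exponential plaquette moment of the RAW iterated averages `Ū^k` with a tilt
budget `a₀` PER LEVEL for ALL level-indexed families `Y` and a coupling-free volume letter `c_V` — as «the natural output of an inductive small-field
analysis» ∕ «quasi-independence of the fluctuation fields across block-averaging scales».  That gloss is WRONG and is withdrawn; the theorems of this
file are unaffected (they are implications, valid for any constants at each `(P, β)`).  What is wrong, and the corrected reading (generation 12):
(1) CLASSICAL SCALE INVARIANCE OVER-TILTS SMOOTH CONFIGURATIONS (desk computation on one explicit configuration; NOT typed).  Let `d = 4`, `m ≥ 1`,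
`L ≥ 3`, `H = diag(1,−1,0,…,0)`, and let `U⋆` be the one-flux-quantum constant-curvature configuration of `T^{(0)}` in the Cartan `U(1)` of `H`
(plaquette angle `f = 2π∕n₀²` in one plane, `n₀ = 2L^{m+K}` sites per direction, the usual seam transition functions; every plaquette of that plane
has holonomy `exp(ifH)`, all others `1`).  At every bond Bałaban's symmetric (0.4) correction factor of `blockAvg expMeanLogSU` is EXACTLY `1` on `U⋆`:
in the small-loop domain the loop variables are `exp(i·f·area·H)` and the mean of their principal logarithms over the uniform family
`Idx P = {0,…,L−1}^d × S_d × S_d` vanishes by the centred-block symmetries `Σ_{r_β}(r_β − (L−1)∕2) = 0` (the `L·n_β` strip) and `Σ_{σ,σ′}(χ_σ − χ_{σ′}) = 0`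
(the stair rectangles `±n_α n_β`); off the domain the guard sets it to `1`.  Hence `Ū⋆ =` the axial transport `=` the constant-curvature configuration of
`T^{(1)}` with angle `f·L²`, and inductively `Ū⋆^k` has angle `f·L^{2k}` on `T^{(k)}` (`n_k = 2L^{m+K−k}`, flux quantum preserved: `f L^{2k} n_k² = 2π`), so
  `S_k(Ū⋆^k) := Σ_{p∈Plaq_k}(1 − reTr Ū⋆^k(∂p)) = (2∕N)·n_k⁴·(1 − cos(2π∕n_k²)) ≥ (1 − π²∕(3n_k⁴))·(2∕N)·2π² ≥ 0.9974·S_0(U⋆)`  for every `k ≤ K`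
(`n_k ≥ 2L ≥ 6`): the Wilson action is scale invariant on smooth configurations, level by level.  Consequently the per-level-tilted multiscale energy
`Q := a₀·Σ_{k≤K} S_k(Ū^k)` (the exponent of (SF) at `Y_k = Plaq_k`, `t_k = a₀`) EXCEEDS the fine action `A = S_0` at `U⋆` as soon as
`K + 1 > 1.003∕a₀` — for `a₀ = 1∕12` and `K = 12`: `Q(U⋆) − A(U⋆) ≥ ((13∕12)·0.9974 − 1)·(2∕N)·2π² ≥ 3.1∕N` — and, all loop variables met in the `K`
averaging steps lying strictly inside the small-loop domain (angles `< f·L^{2k} ≤ 2π∕(2L^m)² ≤ 2π∕36 < min(1∕3, π∕N)` for `N ≤ 17`), `Q − A` is continuous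
near `U⋆`: `Q − A ≥ δ := 1.5∕N` on a Haar ball `B ∋ U⋆` of positive `fieldMeasure`.
(2) CONSEQUENCE FOR (SF) (elementary given (1)).  `∫ e^{βQ} dμ_β = Z⁻¹·∫ e^{β(Q−A)} dU ≥ e^{βδ}·fieldMeasure(B)` (`Z ≤ 1`), so `hSF` at `(P, β)` forces
`c_V·a₀·Σ_{k≤K} #Plaq_k ≥ β·δ − log(1∕fieldMeasure B)`: at a FIXED lattice the letter `c_V` grows at least linearly in `β` (slope `≍ 1∕(N·Σ_k #Plaq_k)`);
NO `β`-uniform («running-coupling-only») `c_V` exists once `K + 1 > 1.003∕a₀`.  The threshold lies at `β` of the order of the number of bonds of `T^{(0)}`,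
far outside the regime `β = g₀⁻² ≍ K·log L` in which §3 is read — this is a statement about the SHAPE of the display, not a numerical obstruction in the
regime.  The renormalisation-group reading agrees: a mode of wavelength `L^m` is smooth for the levels `k ≤ m`, so `Σ_k t_k S_k` charges it `(Σ_{k≤m} t_k)`
times its action — a per-level budget over-tilts every mode of wavelength `≥ L^{1∕a₀}`, far below every threshold and whatever the coupling.  Bałaban's
inductive bounds ([Balaban1989LargeFieldII] (1.79) p. 383) carry one budget per STEP on that step's fluctuation field in the history's own conditional
state; they never tilt the raw averages of all earlier levels at once.
(3) CORRECTED READING OF THE LOCATED WALL (replaces «(SF) per level = Bałaban's RG» here, in module 14's header and in the seat record g7 §3 (b)).  In the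
by-value currency the wall of NE7b is the EVENT law (MSP) — the conclusion shape of §2 ∕ module 11 §3: one level-uniform Peierls factor per pinned cell of an
ADMISSIBLE pattern — which (1) does not touch: over-tilting is a property of the moment (a smooth mode far below every threshold is charged at all the
levels that see it), whereas the cheapest configuration realising a multi-level large-field PATTERN is one fresh fluctuation of action `≍ ε` per pinned
cell, scale-invariantly — exactly the product shape with a level-uniform rate; its proof is the multiscale fluctuation analysis itself (the RG), with no
exponential-moment shortcut: the moment road survives exactly in module 12's `jointExpMoment_levels` (ONE summable budget `Σ_k G^k t_k ≤ 1∕12`, under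
which every smooth mode is charged `< 1` time — stable), whence the level-DEPENDENT rates of module 13.  (SF) stays in this file as a recorded SUFFICIENT
condition for the shape of §2–§3's conclusions; it is not a target a supplier should aim at, and trigger (t4) of the seat record now reads «an (MSP)-type ∕
history-conditional supplier».  Count-neutral; nothing of Bałaban's asserted; NE7b NOT PRINTED ∕ NOT PROVED; N20 NOT discharged. -/
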